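import Summits.AnomalousDissipation.AnomalousDissipation.Theorems.SawtoothPulseCascadeApproxEnvelopeP
import Summits.AnomalousDissipation.AnomalousDissipation.Theorems.SawtoothPulseCascadeApproxAssemblyH

/-!
# The `L²` envelope of the forced linearised response from K2″ WITHIN THE HORIZON, symbolic `δ₀` and cap `C`
(route `AnomalousDissipation/SawtoothPulseCascade`; helper for the crux K1loc = stmt-AnomalousDissipation-19491 — the
weakest form of the K2 crux that the closure K1loc ∧ K2 → Target consumes)

`responseL2EnvelopePH` = `ApproxResponse.responseL2EnvelopePC` (p665105) with the K2 hypothesis weakened to what the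
proof uses: for every lag `A` a threshold `ν₀(A)` and the per-phase cap `(C e^{σ⋆γ})^{J+1−j₀}` only for phases
`j₀ ≤ J < J_{γ²−3}(ν) + A` (strictly below the horizon phase), i.e. only where the analyticity budget
`16π²νN_J²tHalf_J ≤ δ_J²` holds (`pbudget_threshold`) — the viscosity is perturbative at the corner scale in every
phase the hypothesis mentions.  Pipeline: `response_envelope_of_budgetH` (`…ApproxAssemblyH`) + the box arithmetic of
`…ApproxEnvelopeP`.
-/

set_option linter.dupNamespace false

noncomputable section

namespace Summit.AnomalousDissipation.AnomalousDissipation.Theorems.SawtoothPulseCascade.ApproxResponse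

open Set MeasureTheory UnitAddTorus
open scoped ContDiff InnerProductSpace
open Literature.Analysis Literature.Analysis.FunctionSpaces Literature.Analysis.FluidPDE
open Literature.Analysis.FluidPDE.SawtoothCascade
open Literature.Analysis.FluidPDE.SawtoothCascade.CascadeParams
open Summit.AnomalousDissipation.AnomalousDissipation.Theorems.SawtoothPulseCascade.K2Classical

/-- **The geometric `L²` envelope from a K2-cap WITHIN THE HORIZON** (`P = ⟨γ, δ₀, 2, 1, ρN⟩`, `0 < δ₀`, cap `C ≥ 0`
with `C·e^{σ⋆γ} < γ² − 3`): the per-phase cap is only assumed for the phases `J < J_{γ²−3}(ν) + A` below the horizon,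
for each lag `A` with its own threshold `ν₀(A)` (hypothesis `hK2`, the body of `K2PhaseGrowthClassical P C` with the
extra guard) — which is all the closure ever applies (`response_envelope_of_budgetH`).  Conclusion = that of
`responseL2EnvelopePC`: `√∫‖L(t)‖² ≤ K ν (j+1) M₂^{j+1}` up to the horizon, `M₂ = max (C e^{σ⋆γ}) (2ρN) < γ² − 3`. -/
theorem responseL2EnvelopePH {γ : ℝ} (hγ : γ ∈ Icc (5 : ℝ) 8) {δ₀ : ℝ} (hδ₀ : 0 < δ₀) {ρN : ℕ}
    (hρN : ρN ∈ Finset.Icc 2 7) {C : ℝ} (hC0 : 0 ≤ C) (hCr : C * Real.exp (sawSigmaStar * γ) < γ ^ 2 - 3)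
    (hK2 : ∀ A : ℕ, ∃ ν₀ : ℝ, 0 < ν₀ ∧ ∀ ν ∈ Ioc 0 ν₀, ∀ (j₀ J : ℕ), j₀ ≤ J → J < Jrate (γ ^ 2 - 3) ν + A →
      ∀ (hz : Bool) (w₀ : UnitAddTorus (Fin 2) → EuclideanSpace ℝ (Fin 2))
        (w : ℝ → UnitAddTorus (Fin 2) → EuclideanSpace ℝ (Fin 2)) (q : ℝ → UnitAddTorus (Fin 2) → ℝ),
        ShearCombDatum (((⟨γ, δ₀, 2, 1, ρN⟩ : CascadeParams)).N j₀) hz w₀ →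
        Torus.IsSmoothSpaceTimeOn (Icc (CascadeParams.tInject j₀ hz) (CascadeParams.tStart (J + 1))) w →
        Torus.IsSmoothSpaceTimeOn (Icc (CascadeParams.tInject j₀ hz) (CascadeParams.tStart (J + 1))) q →
        (∀ t ∈ Icc (CascadeParams.tInject j₀ hz) (CascadeParams.tStart (J + 1)), Torus.IsDivFree (w t)) →
        (∀ t ∈ Icc (CascadeParams.tInject j₀ hz) (CascadeParams.tStart (J + 1)), ∀ x,
          Torus.timeDerivWithin (Icc (CascadeParams.tInject j₀ hz) (CascadeParams.tStart (J + 1))) w t x +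
            Torus.convect ((⟨γ, δ₀, 2, 1, ρN⟩ : CascadeParams).field t) (w t) x +
            Torus.convect (w t) ((⟨γ, δ₀, 2, 1, ρN⟩ : CascadeParams).field t) x =
            ν • Torus.laplacian (w t) x - Torus.gradient (q t) x) →
        w (CascadeParams.tInject j₀ hz) = w₀ →
        ∀ t ∈ Icc (max (CascadeParams.tInject j₀ hz) (CascadeParams.tStart J)) (CascadeParams.tStart (J + 1)),
          Torus.vectorL2Sq (w t) ≤ (C * Real.exp (sawSigmaStar * γ)) ^ (2 * (J + 1 - j₀)) * Torus.vectorL2Sq w₀) :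
    ∃ M₂ K : ℝ, 0 ≤ M₂ ∧ M₂ < γ ^ 2 - 3 ∧ 0 ≤ K ∧
      ∀ A : ℕ, ∃ ν₀ : ℝ, 0 < ν₀ ∧ ∀ ν ∈ Ioc 0 ν₀, ∀ T' : ℝ,
        DriftFree.horizon (γ ^ 2 - 3) ν A < T' → T' < 1 →
        ∀ (L : ℝ → UnitAddTorus (Fin 2) → EuclideanSpace ℝ (Fin 2)) (q : ℝ → UnitAddTorus (Fin 2) → ℝ),
          Torus.IsSmoothSpaceTimeOn (Icc 0 T') L → Torus.IsSmoothSpaceTimeOn (Icc 0 T') q →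
          (∀ t ∈ Icc 0 T', Torus.IsDivFree (L t)) → L 0 = 0 →
          (∀ t ∈ Icc 0 T', ∀ x, Torus.timeDerivWithin (Icc 0 T') L t x +
            Torus.convect ((⟨γ, δ₀, 2, 1, ρN⟩ : CascadeParams).field t) (L t) x +
            Torus.convect (L t) ((⟨γ, δ₀, 2, 1, ρN⟩ : CascadeParams).field t) x =
              ν • Torus.laplacian (L t) x - Torus.gradient (q t) x +
                ν • Torus.laplacian ((⟨γ, δ₀, 2, 1, ρN⟩ : CascadeParams).field t) x) →
          ∀ j : ℕ, ∀ t ∈ Icc 0 (DriftFree.horizon (γ ^ 2 - 3) ν A),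
            t ∈ Icc (CascadeParams.tStart j) (CascadeParams.tStart (j + 1)) →
            Real.sqrt (Torus.vectorL2Sq (L t)) ≤ K * ν * ((j : ℝ) + 1) * M₂ ^ (j + 1) := by
  set P : CascadeParams := ⟨γ, δ₀, 2, 1, ρN⟩ with hP
  obtain ⟨hρ2, hρ7⟩ := Finset.mem_Icc.1 hρN
  have hρ1 : 1 ≤ ρN := le_trans (by norm_num) hρ2
  have hγ0 : 0 ≤ γ := le_trans (by norm_num) hγ.1
  set M : ℝ := max (C * Real.exp (sawSigmaStar * γ)) (2 * ρN) with hM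
  set K : ℝ := (24 * Real.sqrt Real.pi + 6 * Real.sqrt (2 * Real.pi)) * γ / δ₀ with hK
  have hM1 : 1 ≤ M := le_max_of_le_right (by
    have : (2 : ℝ) ≤ ρN := by exact_mod_cast hρ2
    linarith)
  have hM0 : 0 ≤ M := zero_le_one.trans hM1
  have hMlt : M < γ ^ 2 - 3 := by
    refine max_lt hCr ?_
    have : (ρN : ℝ) ≤ 7 := by exact_mod_cast hρ7
    nlinarith [hγ.1]
  have hK0 : 0 ≤ K := by rw [hK]; positivity
  refine ⟨M, K, hM0, hMlt, hK0, fun A => ?_⟩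
  obtain ⟨ν₁, hν₁, hK2ν⟩ := hK2 A
  obtain ⟨νb, hνb, hbud⟩ := pbudget_threshold hγ hδ₀ hρN A
  refine ⟨min ν₁ νb, lt_min hν₁ hνb, fun ν hν T' hT hT'1 L q hL hq hLdiv hL0 hlin j t ht htj => ?_⟩
  have hν0 : 0 < ν := hν.1
  have hν₁' : ν ∈ Ioc 0 ν₁ := ⟨hν.1, hν.2.trans (min_le_left _ _)⟩
  have hνb' : ν ∈ Ioc 0 νb := ⟨hν.1, hν.2.trans (min_le_right _ _)⟩
  have hRHS : 0 ≤ K * ν * ((j : ℝ) + 1) * M ^ (j + 1) := by positivity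
  set JT : ℕ := Jrate (γ ^ 2 - 3) ν + A with hJT
  have hT_eq : DriftFree.horizon (γ ^ 2 - 3) ν A = tStart JT := rfl
  rw [hT_eq] at ht hT
  by_cases ht0 : t = 0
  · subst ht0
    have h0 : Torus.vectorL2Sq (L 0) = 0 := by
      rw [hL0]; simp [Torus.vectorL2Sq]
    rw [h0, Real.sqrt_zero]
    exact hRHS
  have htpos : 0 < t := lt_of_le_of_ne ht.1 (Ne.symm ht0)
  have hJT1 : 1 ≤ JT := by
    by_contra h
    have h0 : JT = 0 := by omega
    have : tStart JT = 0 := by rw [h0]; rfl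
    linarith [ht.2]
  have hK2JT : CascadeParams.tInject (2 * JT / 2) (2 * JT % 2 == 0) = tStart JT := slotStart_even JT
  obtain ⟨k, hk, htk, hk0⟩ := exists_slot ht.1 (by omega : 0 < 2 * JT) (by rw [hK2JT]; exact ht.2)
  have hJT' : JT - 1 + 1 = JT := by omega
  have hbud' : ∀ j' ≤ JT - 1, 16 * Real.pi ^ 2 * ν * ((P.N j' : ℕ) : ℝ) ^ 2 * tHalf j' ≤ P.δ j' ^ 2 :=
    fun j' hj' => hbud ν hνb' j' (by omega)
  have hJTT : tStart (JT - 1 + 1) ≤ T' := by rw [hJT']; exact hT.le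
  have hk' : k < 2 * (JT - 1 + 1) := by rw [hJT']; exact hk
  have hL0' : L 0 = fun _ => 0 := hL0
  have hK2J : ∀ (j₀ J' : ℕ), j₀ ≤ J' → J' ≤ JT - 1 → _ := fun j₀ J' hj hJ' =>
    hK2ν ν hν₁' j₀ J' hj (by omega)
  have henv := response_envelope_of_budgetH P (by rw [hP]; exact hδ₀) (by norm_num [hP]) hγ0
    (fun j => pbox_N_ne_zero γ δ₀ (by omega) j) hν0 hC0 hK2J hbud' hJTT hT'1
    hL hq hLdiv hL0' hlin hk' htk
  have hC₁0 : 0 ≤ C * Real.exp (sawSigmaStar * γ) := by positivity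
  have h2 := pbox_sum_le γ hγ0 hδ₀ hρ1 hν0.le hC₁0 k
  have hkj : k / 2 ≤ j := by
    rcases hk0 with h0 | hlt
    · simp [h0]
    · have h1 : tStart (k / 2) < tStart (j + 1) := hlt.trans_le htj.2
      have h2 := tStart_strictMono.lt_iff_lt.1 h1
      omega
  have hKν : 0 ≤ K * ν := mul_nonneg hK0 hν0.le
  calc Real.sqrt (Torus.vectorL2Sq (L t)) ≤ _ := henv
    _ ≤ (24 * Real.sqrt Real.pi + 6 * Real.sqrt (2 * Real.pi)) * γ / δ₀ * ν * (((k / 2 : ℕ) : ℝ) + 1) *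
          (max (C * Real.exp (sawSigmaStar * γ)) (2 * ρN)) ^ (k / 2 + 1) := h2
    _ = (K * ν) * ((((k / 2 : ℕ) : ℝ) + 1) * M ^ (k / 2 + 1)) := by rw [hK, hM]; ring
    _ ≤ (K * ν) * (((j : ℝ) + 1) * M ^ (j + 1)) := mul_le_mul_of_nonneg_left (envelope_mono hM1 hkj) hKν
    _ = K * ν * ((j : ℝ) + 1) * M ^ (j + 1) := by ring

end Summit.AnomalousDissipation.AnomalousDissipation.Theorems.SawtoothPulseCascade.ApproxResponse

end
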